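import Summits.Ventures.HodgeRepro2.T5CyclotomicHeckeCommutative

/-!
# FOR EVERY ODD PRIME `ℓ`: `ℚ(ζ_ℓ)⁺/ℚ` is Galois of degree `(ℓ − 1)/2`, and the number of places of `ℚ(ζ_ℓ)⁺` above
# `p ≠ ℓ` is `(ℓ − 1)/o` (even order `o`) or `(ℓ − 1)/(2o)` (odd order)

Tier-5 support N3 / §G-N4.2 (seat p3, gen 79). File 264 proved `ℚ(ζ₇)⁺/ℚ` Galois; the same argument (an
intermediate field of the abelian extension `ℚ(ζ_ℓ)/ℚ`) works for every `ℓ`, and the Galois fundamental identity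
`#{v ∣ p} · e · f = [ℚ(ζ_ℓ)⁺ : ℚ] = (ℓ − 1)/2` with `e = 1` and file 273's `f(v/p) = o/2` or `o` counts the places:

* `plusFieldCyc` (any field of characteristic `0`), `isAbelianGalois_plusFieldCyc`, `isGalois_plusFieldCyc`,
  **`isGalois_maximalRealSubfield_cyc`** — `ℚ(ζ_ℓ)⁺/ℚ` is Galois;
* `finrank_rat_cyc`, **`finrank_rat_maximalRealSubfield_cyc`** — `[ℚ(ζ_ℓ) : ℚ] = ℓ − 1`, `[ℚ(ζ_ℓ)⁺ : ℚ] = (ℓ − 1)/2`;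
* `ramificationIdx_eq_one`, **`ncard_primesOver_int_mul_inertiaDeg`** — `#{v ∣ p} · f(v/p) = (ℓ − 1)/2`;
* **`ncard_primesOver_int_of_even`**, **`ncard_primesOver_int_of_odd`** — `#{v ∣ p} = (ℓ − 1)/o`, resp. `(ℓ − 1)/(2o)`.

§8(d): uses an L-value-free non-vanishing device: NO.
-/

open NumberField NumberField.IsCMField IsDedekindDomain IsDedekindDomain.HeightOneSpectrum Module Polynomial
open Summit.Ventures.HodgeRepro2.T5CyclotomicSevenDegreeOnePrime Summit.Ventures.HodgeRepro2.T5CyclotomicStaysPrimeIffEven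
  Summit.Ventures.HodgeRepro2.T5CyclotomicHeckeCommutative Summit.Ventures.HodgeRepro2.T5FinitePlaceLocalDegree

namespace Summit.Ventures.HodgeRepro2.T5CyclotomicPlusGalois

section Galois

variable (ℓ : ℕ) (K : Type*) [Field K] [CharZero K] [IsCyclotomicExtension {ℓ} ℚ K]

omit [IsCyclotomicExtension {ℓ} ℚ K] in
/-- `K⁺` as an intermediate field of `K/ℚ` (any field `K` of characteristic `0`). -/
noncomputable def plusFieldCyc : IntermediateField ℚ K :=
  (maximalRealSubfield K).toIntermediateField fun q => by
    rw [eq_ratCast]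
    exact SubfieldClass.ratCast_mem _ q

include ℓ in
/-- **`ℚ(ζ_ℓ)⁺/ℚ` is abelian** (an intermediate field of the abelian extension `ℚ(ζ_ℓ)/ℚ`), with the intermediate
field's own `ℚ`-algebra structure. -/
theorem isAbelianGalois_plusFieldCyc :
    @IsAbelianGalois ℚ (plusFieldCyc K) _ _ (IntermediateField.algebra' (plusFieldCyc K)) := by
  haveI := IsCyclotomicExtension.isAbelianGalois {ℓ} ℚ K
  infer_instance

include ℓ in
/-- **`ℚ(ζ_ℓ)⁺/ℚ` is Galois.** -/
theorem isGalois_plusFieldCyc : IsGalois ℚ (plusFieldCyc K) := by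
  have h := (isAbelianGalois_plusFieldCyc ℓ K).toIsGalois
  have e : (IntermediateField.algebra' (plusFieldCyc K) : Algebra ℚ (plusFieldCyc K)) =
      (inferInstance : Algebra ℚ (plusFieldCyc K)) :=
    Subsingleton.elim _ _
  rw [e] at h
  exact h

include ℓ in
/-- **`ℚ(ζ_ℓ)⁺ = maximalRealSubfield ℚ(ζ_ℓ)` is Galois over `ℚ`**, for every `ℓ`. -/
theorem isGalois_maximalRealSubfield_cyc : IsGalois ℚ (maximalRealSubfield K) := isGalois_plusFieldCyc ℓ K

end Galois

section Degree

variable (ℓ : ℕ) [hℓ : Fact ℓ.Prime] (h2 : 2 < ℓ)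
variable (K : Type*) [Field K] [CharZero K] [IsCyclotomicExtension {ℓ} ℚ K]

omit hℓ in
/-- `[ℚ(ζ_ℓ) : ℚ] = φ(ℓ) = ℓ − 1`. -/
theorem finrank_rat_cyc [hℓ : Fact ℓ.Prime] : Module.finrank ℚ K = ℓ - 1 := by
  haveI : NeZero ℓ := ⟨hℓ.out.ne_zero⟩
  rw [IsCyclotomicExtension.Rat.finrank ℓ K, Nat.totient_prime hℓ.out]

include h2 in
/-- **`[ℚ(ζ_ℓ)⁺ : ℚ] = (ℓ − 1)/2`** (the tower law with `[ℚ(ζ_ℓ) : ℚ(ζ_ℓ)⁺] = 2`). -/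
theorem finrank_rat_maximalRealSubfield_cyc :
    haveI := numberFieldCyc ℓ K; haveI := isCMFieldCyc ℓ h2 K
    Module.finrank ℚ (maximalRealSubfield K) = (ℓ - 1) / 2 := by
  haveI := numberFieldCyc ℓ K
  haveI := isCMFieldCyc ℓ h2 K
  have h := Module.finrank_mul_finrank ℚ (maximalRealSubfield K) K
  rw [Algebra.IsQuadraticExtension.finrank_eq_two (maximalRealSubfield K) K, finrank_rat_cyc ℓ K] at h
  omega

end Degree

section Count

variable (ℓ : ℕ) [hℓ : Fact ℓ.Prime] (h2 : 2 < ℓ)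
variable (K : Type*) [Field K] [CharZero K] [IsCyclotomicExtension {ℓ} ℚ K]
variable (p : ℕ) [hp : Fact p.Prime] (hn : p.Coprime ℓ)
variable (v : HeightOneSpectrum (𝓞 (maximalRealSubfield K))) [hv : v.asIdeal.LiesOver (Ideal.span {(p : ℤ)})]
include hn hv

/-- **`e(v/p) = 1`** for `p ≠ ℓ` (the tower law with `e(w/p) = 1`). -/
theorem ramificationIdx_eq_one :
    haveI := numberFieldCyc ℓ K
    v.asIdeal.ramificationIdx ℤ = 1 := by
  haveI := numberFieldCyc ℓ K
  obtain ⟨⟨P, hP, hPo⟩⟩ := Ideal.nonempty_primesOver (S := 𝓞 K) v.asIdeal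
  haveI := hP
  haveI := hPo
  haveI : P.LiesOver (Ideal.span {(p : ℤ)}) := Ideal.LiesOver.trans P v.asIdeal _
  have htower := Ideal.ramificationIdx_tower (R := ℤ) v.asIdeal P
  rw [IsCyclotomicExtension.Rat.ramificationIdx_eq_of_not_dvd (m := ℓ) p K P
    ((Nat.Prime.coprime_iff_not_dvd hp.out).mp hn)] at htower
  exact Nat.eq_one_of_mul_eq_one_right htower.symm

include h2 in
/-- **`#{v ∣ p} · f(v/p) = (ℓ − 1)/2`**: the Galois fundamental identity on `ℚ(ζ_ℓ)⁺/ℚ` with `e(v/p) = 1`. -/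
theorem ncard_primesOver_int_mul_inertiaDeg :
    haveI := numberFieldCyc ℓ K; haveI := isCMFieldCyc ℓ h2 K
    ((Ideal.span {(p : ℤ)}).primesOver (𝓞 (maximalRealSubfield K))).ncard * v.asIdeal.inertiaDeg ℤ =
      (ℓ - 1) / 2 := by
  haveI := numberFieldCyc ℓ K
  haveI := isCMFieldCyc ℓ h2 K
  haveI := isGalois_maximalRealSubfield_cyc ℓ K
  haveI : (Ideal.span {(p : ℤ)}).IsPrime :=
    (Ideal.span_singleton_prime (Nat.cast_ne_zero.mpr hp.out.ne_zero)).mpr (Nat.prime_iff_prime_int.mp hp.out)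
  have h := Ideal.ncard_primesOver_mul_ramificationIdxIn_mul_inertiaDegIn (Ideal.span {(p : ℤ)})
    (𝓞 (maximalRealSubfield K)) (maximalRealSubfield K ≃ₐ[ℚ] maximalRealSubfield K)
  rw [Ideal.inertiaDegIn_eq_inertiaDeg _ v.asIdeal (maximalRealSubfield K ≃ₐ[ℚ] maximalRealSubfield K),
    Ideal.ramificationIdxIn_eq_ramificationIdx _ v.asIdeal (maximalRealSubfield K ≃ₐ[ℚ] maximalRealSubfield K),
    IsGaloisGroup.card_eq_finrank (maximalRealSubfield K ≃ₐ[ℚ] maximalRealSubfield K) ℚ (maximalRealSubfield K),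
    finrank_rat_maximalRealSubfield_cyc ℓ h2 K, ramificationIdx_eq_one ℓ K p hn v, one_mul] at h
  exact h

include h2 in
/-- **`f(v/p) = o/2` when `o = orderOf (p mod ℓ)` is even** (file 273's `N(v) = p^{o/2}`). -/
theorem inertiaDeg_eq_of_even (heven : Even (orderOf (p : ZMod ℓ))) :
    haveI := numberFieldCyc ℓ K; haveI := isCMFieldCyc ℓ h2 K
    v.asIdeal.inertiaDeg ℤ = orderOf (p : ZMod ℓ) / 2 := by
  haveI := numberFieldCyc ℓ K
  haveI := isCMFieldCyc ℓ h2 K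
  obtain ⟨⟨P, hP, hPo⟩⟩ := Ideal.nonempty_primesOver (S := 𝓞 K) v.asIdeal
  haveI := hP
  haveI := hPo
  have ho := inertiaDeg_mul_eq_orderOf ℓ K p hn v ⟨P, hP, Ideal.ne_bot_of_liesOver_of_ne_bot v.ne_bot P⟩
    (hw := hPo)
  rw [inertiaDeg_over_eq_two_of_even ℓ h2 K p hn v ⟨P, hP, Ideal.ne_bot_of_liesOver_of_ne_bot v.ne_bot P⟩
    (hw := hPo) heven] at ho
  omega

include h2 in
/-- **`f(v/p) = o` when `o = orderOf (p mod ℓ)` is odd.** -/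
theorem inertiaDeg_eq_of_odd (hodd : Odd (orderOf (p : ZMod ℓ))) :
    haveI := numberFieldCyc ℓ K; haveI := isCMFieldCyc ℓ h2 K
    v.asIdeal.inertiaDeg ℤ = orderOf (p : ZMod ℓ) := by
  haveI := numberFieldCyc ℓ K
  haveI := isCMFieldCyc ℓ h2 K
  obtain ⟨⟨P, hP, hPo⟩⟩ := Ideal.nonempty_primesOver (S := 𝓞 K) v.asIdeal
  haveI := hP
  haveI := hPo
  have ho := inertiaDeg_mul_eq_orderOf ℓ K p hn v ⟨P, hP, Ideal.ne_bot_of_liesOver_of_ne_bot v.ne_bot P⟩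
    (hw := hPo)
  rw [inertiaDeg_over_eq_one_of_odd ℓ h2 K p hn v ⟨P, hP, Ideal.ne_bot_of_liesOver_of_ne_bot v.ne_bot P⟩
    (hw := hPo) hodd, mul_one] at ho
  exact ho

include h2 in
/-- **`#{v ∣ p} = (ℓ − 1)/o` when `o = orderOf (p mod ℓ)` is even.** -/
theorem ncard_primesOver_int_of_even (heven : Even (orderOf (p : ZMod ℓ))) :
    haveI := numberFieldCyc ℓ K; haveI := isCMFieldCyc ℓ h2 K
    ((Ideal.span {(p : ℤ)}).primesOver (𝓞 (maximalRealSubfield K))).ncard = (ℓ - 1) / orderOf (p : ZMod ℓ) := by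
  haveI := numberFieldCyc ℓ K
  haveI := isCMFieldCyc ℓ h2 K
  have h := ncard_primesOver_int_mul_inertiaDeg ℓ h2 K p hn v
  rw [inertiaDeg_eq_of_even ℓ h2 K p hn v heven] at h
  obtain ⟨m, hm⟩ := heven
  have hm0 : 0 < m := by
    have hpos : 0 < orderOf (p : ZMod ℓ) := by
      rw [← orderOf_unitOfCoprime ℓ p hn]
      exact orderOf_pos _
    omega
  rw [hm, show m + m = 2 * m by ring, Nat.mul_div_cancel_left m two_pos] at h
  have hodd : ¬ 2 ∣ ℓ := by
    intro h2l
    exact absurd ((Nat.prime_dvd_prime_iff_eq Nat.prime_two hℓ.out).mp h2l) (by omega)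
  have hℓ1 : (ℓ - 1) / (2 * m) = (ℓ - 1) / 2 / m := (Nat.div_div_eq_div_mul _ _ _).symm
  rw [hm, show m + m = 2 * m by ring, hℓ1, ← h, Nat.mul_div_cancel _ hm0]

include h2 in
/-- **`#{v ∣ p} = (ℓ − 1)/(2o)` when `o = orderOf (p mod ℓ)` is odd.** -/
theorem ncard_primesOver_int_of_odd (hodd : Odd (orderOf (p : ZMod ℓ))) :
    haveI := numberFieldCyc ℓ K; haveI := isCMFieldCyc ℓ h2 K
    ((Ideal.span {(p : ℤ)}).primesOver (𝓞 (maximalRealSubfield K))).ncard =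
      (ℓ - 1) / (2 * orderOf (p : ZMod ℓ)) := by
  haveI := numberFieldCyc ℓ K
  haveI := isCMFieldCyc ℓ h2 K
  have h := ncard_primesOver_int_mul_inertiaDeg ℓ h2 K p hn v
  rw [inertiaDeg_eq_of_odd ℓ h2 K p hn v hodd] at h
  have hpos : 0 < orderOf (p : ZMod ℓ) := by
    rw [← orderOf_unitOfCoprime ℓ p hn]
    exact orderOf_pos _
  rw [← Nat.div_div_eq_div_mul, ← h]
  exact (Nat.mul_div_cancel _ hpos).symm

end Count

end Summit.Ventures.HodgeRepro2.T5CyclotomicPlusGalois
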